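import Literature.AlgebraicGeometry.Morphisms.SteinOfFormalLevels
import Literature.AlgebraicGeometry.Morphisms.SectionsFlatBaseChange
import Literature.AlgebraicGeometry.Morphisms.ZariskiConnectednessProper
import Literature.AlgebraicGeometry.Resolution.AdicNoetherian
import Mathlib.RingTheory.AdicCompletion.LocalRing
import Mathlib.RingTheory.AdicCompletion.AsTensorProduct
import Mathlib.RingTheory.AdicCompletion.Noetherian
import Mathlib.RingTheory.Flat.Basic
import HarnessLib

/-!
# Global functions on a proper scheme over a Noetherian local ring from its formal levels

Topic `Literature/AlgebraicGeometry/Morphisms`; theorems only (no definition, no named fact, no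
instance). Let `(R, 𝔪)` be a Noetherian local ring and `f : X → Spec R` proper such that every
infinitesimal level is Stein, `R/𝔪ⁿ⁺¹ ⥲ Γ(X ×_R R/𝔪ⁿ⁺¹, 𝒪)`. Then `R ⥲ Γ(X, 𝒪_X)`
(`bijective_algebraMapΓ_of_isLocalRing`). Proof: base change to the completion `R̂`
([AtiyahMacdonald1969] Ch. 10; Mathlib `AdicCompletion`, Noetherian by the tree's
`Resolution/AdicNoetherian`, `𝔪̂`-adically complete, flat over `R`): the levels of `X_{R̂} → Spec R̂`
are those of `X` (`R̂/𝔪̂ⁿ = R/𝔪ⁿ`), so `R̂ ⥲ Γ(X_{R̂}, 𝒪)` by the complete case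
(`Morphisms/SteinOfFormalLevels`); flat base change of `H⁰` ([StacksProject, Tag 02KH]; tree
`SectionsFlatBaseChange`) identifies this map with `R̂ ⊗_R (R → Γ(X, 𝒪_X))`, and a linear map of
finite `R`-modules (finiteness of `Γ(X, 𝒪_X)`: [StacksProject, Tag 02O5], tree
`ZariskiConnectednessProper`) which becomes bijective after `R̂ ⊗_R −` is bijective, finite modules
over a Noetherian local ring being `𝔪`-adically separated ([AtiyahMacdonald1969] Prop. 10.13,
Thm. 10.17, Cor. 10.19).

* `bijective_of_lTensor_adicCompletion_bijective` — descent of bijectivity along `R̂ ⊗_R −` for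
  finite modules over a Noetherian local ring;
* `bijective_algebraMapΓ_baseChange_iff_lTensor` — for a flat `R`-algebra `R'`, Stein of
  `X ×_R R'` iff `R' ⊗_R (R → Γ(X, 𝒪_X))` is bijective (flat base change of `H⁰`);
* `bijective_algebraMapΓ_of_bijective_baseChange_adicCompletion` — `R̂ ⥲ Γ(X_{R̂}, 𝒪)` implies
  `R ⥲ Γ(X, 𝒪_X)` for `f` proper;
* `bijective_algebraMapΓ_of_isLocalRing` — Stein from the formal levels over a Noetherian local
  ring (the consumer is the universal Stein property of abelian schemes, [GortzWedhorn2023]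
  Cor. 24.63, whose Artin-local levels are supplied separately).

## References
* [AtiyahMacdonald1969] M. Atiyah, I. Macdonald, *Introduction to Commutative Algebra*, Ch. 10:
  Prop. 10.13, Prop. 10.14, Thm. 10.17, Cor. 10.19.
* [StacksProject] The Stacks Project, Tag 02KH (flat base change, degree 0), Tag 02O5 (finiteness,
  degree 0), Tag 0316 (the completion of a Noetherian ring is Noetherian).
* [GortzWedhorn2023] U. Görtz, T. Wedhorn, *Algebraic Geometry II*, Thm. 24.37, Cor. 24.63.
-/

noncomputable section

open CategoryTheory CategoryTheory.Limits AlgebraicGeometry TopologicalSpace Opposite IsLocalRing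
open TensorProduct

universe u

namespace Literature.AlgebraicGeometry.Morphisms

open infinitesimalNeighbourhood

/-! ## §1 Descent of bijectivity along `R̂ ⊗_R −` -/

section Algebra

variable {R : Type u} [CommRing R] [IsNoetherianRing R] [IsLocalRing R]

/-- A finite module over a Noetherian local ring killed by `R̂ ⊗_R −` is zero (`R̂ ⊗_R P = P̂` and
`P → P̂` is injective, `P` being `𝔪`-adically separated). [cite: AtiyahMacdonald1969, Prop. 10.13
and Thm. 10.17] -/
private theorem subsingleton_of_subsingleton_tensor_adicCompletion {P : Type u} [AddCommGroup P]
    [Module R P] [Module.Finite R P]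
    (h : Subsingleton (AdicCompletion (maximalIdeal R) R ⊗[R] P)) : Subsingleton P := by
  haveI : Subsingleton (AdicCompletion (maximalIdeal R) P) :=
    (AdicCompletion.ofTensorProductEquivOfFiniteNoetherian (maximalIdeal R) P).symm.toEquiv
      |>.subsingleton
  exact (AdicCompletion.of_injective (maximalIdeal R) P).subsingleton

/-- **Descent of bijectivity along the completion.** Let `R` be a Noetherian local ring with
completion `R̂` and `φ : N → M` a linear map of finite `R`-modules. If `R̂ ⊗_R φ` is bijective, so is
`φ`: `R̂` is flat over `R`, so `R̂ ⊗_R ker φ` and `R̂ ⊗_R coker φ` vanish, and a finite `R`-module `P`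
with `R̂ ⊗_R P = P̂ = 0` is zero since `P → P̂` is injective (Krull). [cite: AtiyahMacdonald1969,
Prop. 10.13, Prop. 10.14 and Thm. 10.17] -/
theorem bijective_of_lTensor_adicCompletion_bijective {N M : Type u} [AddCommGroup N] [Module R N]
    [AddCommGroup M] [Module R M] [Module.Finite R N] [Module.Finite R M] (φ : N →ₗ[R] M)
    (h : Function.Bijective (φ.lTensor (AdicCompletion (maximalIdeal R) R))) :
    Function.Bijective φ := by
  set Rh := AdicCompletion (maximalIdeal R) R
  constructor
  · -- kernel
    set K := LinearMap.ker φ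
    have hex : Function.Exact (K.subtype.lTensor Rh) (φ.lTensor Rh) :=
      Module.Flat.lTensor_exact Rh (LinearMap.exact_subtype_ker_map φ)
    have hinj : Function.Injective (K.subtype.lTensor Rh) :=
      Module.Flat.lTensor_preserves_injective_linearMap K.subtype K.injective_subtype
    -- `R̂ ⊗ K → R̂ ⊗ N` is injective with image `ker (R̂ ⊗ φ) = 0`
    have hzero : ∀ x : Rh ⊗[R] K, x = 0 := fun x => by
      apply hinj
      rw [map_zero]
      have hx : K.subtype.lTensor Rh x ∈ LinearMap.ker (φ.lTensor Rh) := by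
        rw [LinearMap.mem_ker]
        exact hex.apply_apply_eq_zero x
      rwa [LinearMap.ker_eq_bot.mpr h.1, Submodule.mem_bot] at hx
    haveI : Subsingleton (Rh ⊗[R] K) := subsingleton_of_forall_eq 0 hzero
    haveI : Subsingleton K := subsingleton_of_subsingleton_tensor_adicCompletion (R := R) inferInstance
    rw [← LinearMap.ker_eq_bot]
    exact Submodule.eq_bot_iff _ |>.mpr fun x hx => congrArg Subtype.val
      (Subsingleton.elim (⟨x, hx⟩ : K) 0)
  · -- cokernel
    set C := M ⧸ LinearMap.range φ
    have hex : Function.Exact (φ.lTensor Rh) ((LinearMap.range φ).mkQ.lTensor Rh) :=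
      Module.Flat.lTensor_exact Rh (LinearMap.exact_map_mkQ_range φ)
    have hsurj : Function.Surjective ((LinearMap.range φ).mkQ.lTensor Rh) :=
      LinearMap.lTensor_surjective Rh (Submodule.mkQ_surjective _)
    -- `R̂ ⊗ M → R̂ ⊗ C` is surjective and zero
    have hzero : ∀ y : Rh ⊗[R] C, y = 0 := fun y => by
      obtain ⟨x, rfl⟩ := hsurj y
      obtain ⟨z, rfl⟩ := h.2 x
      exact hex.apply_apply_eq_zero z
    haveI : Subsingleton (Rh ⊗[R] C) := subsingleton_of_forall_eq 0 hzero
    haveI : Subsingleton C := subsingleton_of_subsingleton_tensor_adicCompletion (R := R) inferInstance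
    rw [← LinearMap.range_eq_top]
    rw [← Submodule.ker_mkQ (LinearMap.range φ), LinearMap.ker_eq_top]
    ext x
    exact Subsingleton.elim _ _

end Algebra

/-! ## §2 Plumbing: Stein base changes along isomorphic and composite bases -/

section Plumbing

variable {R : Type u} [CommRing R] {X : Scheme.{u}} (f : X ⟶ Spec (.of R))

/-- Along a commutative triangle `z ≫ g = h` over `Spec B`, pulling back global functions sends
`algebraMapΓ g b` to `algebraMapΓ h b`. [folklore] -/
private theorem appTop_algebraMapΓ_of_triangle {B : Type u} [CommRing B] {Y Z : Scheme.{u}}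
    (g : Y ⟶ Spec (.of B)) (h : Z ⟶ Spec (.of B)) (z : Z ⟶ Y) (w : z ≫ g = h) (b : B) :
    z.appTop.hom (algebraMapΓ g b) = algebraMapΓ h b := by
  subst w
  change (g.appTop ≫ z.appTop).hom ((Scheme.ΓSpecIso (.of B)).inv.hom b) = _
  rw [← Scheme.Hom.comp_appTop]
  rfl

/-- For a commutative square `z ≫ g = h ≫ Spec φ`, pulling back global functions sends
`algebraMapΓ g b` to `algebraMapΓ h (φ b)`. [folklore] -/
private theorem appTop_algebraMapΓ_of_square {B C : Type u} [CommRing B] [CommRing C]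
    {Y Z : Scheme.{u}} (g : Y ⟶ Spec (.of B)) (h : Z ⟶ Spec (.of C)) (z : Z ⟶ Y)
    (φ : B →+* C) (w : z ≫ g = h ≫ Spec.map (CommRingCat.ofHom φ)) (b : B) :
    z.appTop.hom (algebraMapΓ g b) = algebraMapΓ h (φ b) := by
  have e1 : (g.appTop ≫ z.appTop).hom =
      ((Spec.map (CommRingCat.ofHom φ)).appTop ≫ h.appTop).hom := by
    rw [← Scheme.Hom.comp_appTop, ← Scheme.Hom.comp_appTop, w]
  have e2 : (CommRingCat.ofHom φ ≫ (Scheme.ΓSpecIso (.of C)).inv).hom =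
      ((Scheme.ΓSpecIso (.of B)).inv ≫ (Spec.map (CommRingCat.ofHom φ)).appTop).hom := by
    rw [Scheme.ΓSpecIso_inv_naturality]
  have e3 := congr($e1 ((Scheme.ΓSpecIso (.of B)).inv.hom b))
  have e4 := congr($e2 b)
  simp only [CommRingCat.hom_comp, CommRingCat.hom_ofHom, RingHom.coe_comp,
    Function.comp_apply] at e3 e4
  rw [algebraMapΓ, algebraMapΓ, RingHom.comp_apply, RingHom.comp_apply, e3, e4]

/-- Stein is invariant under an isomorphism over the base. [folklore] -/
private theorem bijective_algebraMapΓ_of_iso_over {B : Type u} [CommRing B] {P Q : Scheme.{u}}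
    (hP : P ⟶ Spec (.of B)) (hQ : Q ⟶ Spec (.of B)) (k : P ≅ Q) (w : k.hom ≫ hQ = hP)
    (h : Function.Bijective (algebraMapΓ hQ)) : Function.Bijective (algebraMapΓ hP) := by
  have e : (algebraMapΓ hP : B → Γ(P, ⊤)) = k.hom.appTop.hom ∘ algebraMapΓ hQ := by
    funext b
    exact (appTop_algebraMapΓ_of_triangle hQ hP k.hom w b).symm
  rw [e]
  haveI : IsIso k.hom.appTop := by
    change IsIso (k.hom.app ⊤)
    infer_instance
  exact (ConcreteCategory.bijective_of_isIso k.hom.appTop).comp h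

/-- Stein for the base change along `b' ≫ b` is Stein for the iterated base change (pasting,
Mathlib `pullbackLeftPullbackSndIso`). [folklore] -/
private theorem bijective_algebraMapΓ_snd_snd_of_comp {B C : Type u} [CommRing B] [CommRing C]
    (b : Spec (.of B) ⟶ Spec (.of R)) (b' : Spec (.of C) ⟶ Spec (.of B))
    (h : Function.Bijective (algebraMapΓ (pullback.snd f (b' ≫ b)))) :
    Function.Bijective (algebraMapΓ (pullback.snd (pullback.snd f b) b')) :=
  bijective_algebraMapΓ_of_iso_over _ _ (pullbackLeftPullbackSndIso f b b')
    (pullbackLeftPullbackSndIso_hom_snd f b b') h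

/-- Stein for the base change along `b₁ : Spec B₁ → Spec R` gives Stein for the base change along
`Spec e ≫ b₁` for a ring isomorphism `e : B₁ ≃+* B₂`. [folklore] -/
private theorem bijective_algebraMapΓ_snd_of_ringEquiv {B₁ B₂ : Type u} [CommRing B₁] [CommRing B₂]
    (b₁ : Spec (.of B₁) ⟶ Spec (.of R)) (e : B₁ ≃+* B₂)
    (h : Function.Bijective (algebraMapΓ (pullback.snd f b₁))) :
    Function.Bijective
      (algebraMapΓ (pullback.snd f (Spec.map (CommRingCat.ofHom e.toRingHom) ≫ b₁))) := by
  set ε : Spec (.of B₂) ⟶ Spec (.of B₁) := Spec.map (CommRingCat.ofHom e.toRingHom)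
  haveI : IsIso ε := by
    change IsIso (Scheme.Spec.map (CommRingCat.ofHom e.toRingHom).op)
    haveI : IsIso (CommRingCat.ofHom e.toRingHom) :=
      (inferInstance : IsIso e.toCommRingCatIso.hom)
    infer_instance
  -- the iterated base change `Q = (X ×_R B₁) ×_{B₁} B₂`, whose first projection is an isomorphism
  refine bijective_algebraMapΓ_of_iso_over _ _ (pullbackLeftPullbackSndIso f b₁ ε).symm
    (pullbackLeftPullbackSndIso_inv_snd_snd f b₁ ε) ?_
  haveI : IsIso (pullback.fst (pullback.snd f b₁) ε) := inferInstance
  haveI : IsIso (pullback.fst (pullback.snd f b₁) ε).appTop := by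
    change IsIso ((pullback.fst (pullback.snd f b₁) ε).app ⊤)
    infer_instance
  have hsq := appTop_algebraMapΓ_of_square (pullback.snd f b₁)
    (pullback.snd (pullback.snd f b₁) ε) (pullback.fst (pullback.snd f b₁) ε) e.toRingHom
    pullback.condition
  have heq : (algebraMapΓ (pullback.snd (pullback.snd f b₁) ε) : B₂ → _) =
      (pullback.fst (pullback.snd f b₁) ε).appTop.hom ∘ algebraMapΓ (pullback.snd f b₁) ∘
        e.symm := by
    funext c
    simp only [Function.comp_apply, hsq, RingEquiv.toRingHom_eq_coe, RingEquiv.coe_toRingHom,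
      RingEquiv.apply_symm_apply]
  rw [heq]
  exact ((ConcreteCategory.bijective_of_isIso (pullback.fst (pullback.snd f b₁) ε).appTop).comp
    h).comp e.symm.bijective

end Plumbing

/-! ## §2b Flat base change: Stein of `X ×_R R'` versus `R' ⊗_R (R → Γ(X, 𝒪_X))` -/

section FlatBaseChange

variable {R R' : Type u} [CommRing R] [CommRing R'] [Algebra R R'] [Module.Flat R R']
  {X : Scheme.{u}} (f : X ⟶ Spec (.of R)) [CompactSpace X] [QuasiSeparatedSpace X]

/-- **Flat base change of the Stein property.** For `f : X → Spec R` quasi-compact quasi-separated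
and a flat `R`-algebra `R'`, the structure map `R' → Γ(X ×_R R', 𝒪)` is bijective iff
`R' ⊗_R (R → Γ(X, 𝒪_X))` is: flat base change identifies `Γ(X ×_R R', 𝒪)` with
`R' ⊗_R Γ(X, 𝒪_X)` (tree `bcSections_bijective`), compatibly with the structure maps.
[cite: StacksProject, Tag 02KH (Cohomology of Schemes, Lemma 30.5.2), degree 0] -/
theorem bijective_algebraMapΓ_baseChange_iff_lTensor :
    Function.Bijective (algebraMapΓ
        (pullback.snd f (Spec.map (CommRingCat.ofHom (algebraMap R R'))))) ↔
      Function.Bijective ((Algebra.linearMap R (Sections f ⊤)).lTensor R') := by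
  set bι : Spec (.of R') ⟶ Spec (.of R) := Spec.map (CommRingCat.ofHom (algebraMap R R'))
  set f' := pullback.snd f bι
  set g := pullback.fst f bι
  have H : IsPullback g f' f bι := IsPullback.of_hasPullback f bι
  have hΦ := bcSections_bijective f f' g H (V := ⊤) isCompact_univ isQuasiSeparated_univ
  set Φ := bcSections f f' g H.w (le_refl (g ⁻¹ᵁ ⊤))
  set φ : R →ₗ[R] Sections f ⊤ := Algebra.linearMap R (Sections f ⊤)
  -- `R' → Γ(X', g⁻¹⊤)` is the structure map up to `g⁻¹⊤ = ⊤`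
  have hpre : ∀ (W : (pullback f bι).Opens), W = ⊤ →
      (Function.Bijective (fun b : R' => resTop (pullback f bι) W (algebraMapΓ f' b)) ↔
        Function.Bijective (algebraMapΓ f')) := by
    intro W hW
    subst hW
    have e : (fun b : R' => resTop (pullback f bι) ⊤ (algebraMapΓ f' b)) = algebraMapΓ f' := by
      funext b; exact resTop_top _ _
    rw [e]
  have htop : g ⁻¹ᵁ (⊤ : X.Opens) = ⊤ := by ext; simp
  rw [← hpre (g ⁻¹ᵁ ⊤) htop]
  -- and it factors as `Φ ∘ (R' ⊗ φ) ∘ (R' ≅ R' ⊗ R)`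
  have hfac : (fun b : R' => resTop (pullback f bι) (g ⁻¹ᵁ ⊤) (algebraMapΓ f' b)) =
      (fun t => (Φ t : Γ(pullback f bι, g ⁻¹ᵁ ⊤))) ∘ φ.lTensor R' ∘ (TensorProduct.rid R R').symm := by
    funext b
    simp only [Function.comp_apply, TensorProduct.rid_symm_apply, LinearMap.lTensor_tmul]
    change _ = Algebra.TensorProduct.productMap (toSectionsBase R f' (g ⁻¹ᵁ ⊤))
      (Sections.comap f (restrictBase R f') g H.w (le_refl _)) (b ⊗ₜ φ 1)
    rw [Algebra.TensorProduct.productMap_apply_tmul]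
    have h1 : φ 1 = 1 := by
      change algebraMap R (Sections f ⊤) 1 = 1
      exact map_one _
    rw [h1, map_one, mul_one]
    rfl
  rw [hfac]
  constructor
  · intro h
    have h1 : Function.Bijective (φ.lTensor R' ∘ (TensorProduct.rid R R').symm) :=
      (Function.Bijective.of_comp_iff' hΦ _).mp h
    exact (Function.Bijective.of_comp_iff _ (TensorProduct.rid R R').symm.bijective).mp h1
  · intro h
    exact hΦ.comp (h.comp (TensorProduct.rid R R').symm.bijective)

omit [Module.Flat R R'] [CompactSpace X] [QuasiSeparatedSpace X] in
/-- The structure map `R → Γ(X, 𝒪_X)` is `algebraMapΓ f` (through the `Sections` synonym).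
[folklore] -/
private theorem bijective_algebraMapΓ_iff_linearMap :
    Function.Bijective (algebraMapΓ f) ↔
      Function.Bijective (Algebra.linearMap R (Sections f ⊤)) := by
  have e : (algebraMapΓ f : R → Γ(X, ⊤)) = fun r => (Algebra.linearMap R (Sections f ⊤) r : Γ(X, ⊤)) := by
    funext r
    change algebraMapΓ f r = algebraMap R (Sections f ⊤) r
    rw [Sections.algebraMap_apply]
    exact (resTop_top X _).symm
  rw [e]; rfl

end FlatBaseChange

/-! ## §3 The levels of the completion -/

section Completion

variable {R : Type u} [CommRing R] [IsNoetherianRing R] [IsLocalRing R]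

/-- The kernel of `R̂ → R/𝔪ⁿ` is `𝔪̂ⁿ` (Mathlib `pow_smul_top_eq_ker_eval`, `maximalIdeal_eq_map`).
[cite: AtiyahMacdonald1969, Prop. 10.15] -/
private theorem ker_evalₐ_eq_maximalIdeal_pow (n : ℕ) :
    RingHom.ker (AdicCompletion.evalₐ (maximalIdeal R) n).toRingHom =
      maximalIdeal (AdicCompletion (maximalIdeal R) R) ^ n := by
  have fg : (maximalIdeal R).FG := (maximalIdeal R).fg_of_isNoetherianRing
  ext x
  rw [RingHom.mem_ker, AdicCompletion.maximalIdeal_eq_map, ← Ideal.map_pow]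
  have hle : maximalIdeal R ^ n ≤ maximalIdeal R ^ n • ⊤ := by
    rw [Ideal.smul_eq_mul, Ideal.mul_top]
  have hinj : Function.Injective (Ideal.Quotient.factor hle) := by
    rw [RingHom.injective_iff_ker_eq_bot, Ideal.Quotient.factor_ker]
    exact Ideal.map_mk_eq_bot_of_le (by rw [Ideal.smul_eq_mul, Ideal.mul_top])
  have h1 : (AdicCompletion.evalₐ (maximalIdeal R) n).toRingHom x = 0 ↔
      x ∈ LinearMap.ker (AdicCompletion.eval (maximalIdeal R) R n) := by
    rw [LinearMap.mem_ker, ← AdicCompletion.factor_evalₐ_eq_eval (maximalIdeal R) x hle]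
    change AdicCompletion.evalₐ (maximalIdeal R) n x = 0 ↔ _
    constructor
    · intro h
      rw [h, map_zero]
    · intro h
      exact hinj (h.trans (map_zero _).symm)
  rw [h1, ← AdicCompletion.pow_smul_top_eq_ker_eval fg, Ideal.smul_top_eq_map]
  rfl

/-- The induced ring isomorphism `R̂/𝔪̂ⁿ ≃ R/𝔪ⁿ`, compatible with the projections from `R`.
[cite: AtiyahMacdonald1969, Prop. 10.15] -/
private theorem exists_ringEquiv_quotient_adicCompletion (n : ℕ) :
    ∃ e : R ⧸ maximalIdeal R ^ n ≃+*
        AdicCompletion (maximalIdeal R) R ⧸ maximalIdeal (AdicCompletion (maximalIdeal R) R) ^ n,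
      e.toRingHom.comp (Ideal.Quotient.mk (maximalIdeal R ^ n)) =
        (Ideal.Quotient.mk (maximalIdeal (AdicCompletion (maximalIdeal R) R) ^ n)).comp
          (algebraMap R (AdicCompletion (maximalIdeal R) R)) := by
  set Rh := AdicCompletion (maximalIdeal R) R
  let ε₀ : Rh ⧸ RingHom.ker (AdicCompletion.evalₐ (maximalIdeal R) n).toRingHom ≃+*
      R ⧸ maximalIdeal R ^ n :=
    RingHom.quotientKerEquivOfSurjective (AdicCompletion.surjective_evalₐ (maximalIdeal R) n)
  let ε : Rh ⧸ maximalIdeal Rh ^ n ≃+* R ⧸ maximalIdeal R ^ n :=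
    (Ideal.quotEquivOfEq (ker_evalₐ_eq_maximalIdeal_pow n).symm).trans ε₀
  refine ⟨ε.symm, ?_⟩
  apply RingHom.ext
  intro r
  rw [RingHom.comp_apply, RingHom.comp_apply, RingEquiv.toRingHom_eq_coe, RingEquiv.coe_toRingHom,
    RingEquiv.symm_apply_eq]
  change _ = ε₀ (Ideal.quotEquivOfEq (ker_evalₐ_eq_maximalIdeal_pow n).symm
    (Ideal.Quotient.mk (maximalIdeal Rh ^ n) (algebraMap R Rh r)))
  rw [Ideal.quotEquivOfEq_mk, RingHom.quotientKerEquivOfSurjective_apply_mk]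
  change _ = AdicCompletion.evalₐ (maximalIdeal R) n (algebraMap R Rh r)
  rw [AdicCompletion.algebraMap_apply]
  exact (AdicCompletion.evalₐ_of (maximalIdeal R) n r).symm

end Completion

/-! ## §4 Stein from the formal levels over a Noetherian local ring -/

section Main

variable {R : Type u} [CommRing R] [IsNoetherianRing R] [IsLocalRing R] {X : Scheme.{u}}
  (f : X ⟶ Spec (.of R)) [IsProper f]

/-- **Descent from the completion.** For `f : X → Spec R` proper over a Noetherian local ring with
completion `R̂`: if `R̂ → Γ(X ×_R R̂, 𝒪)` is bijective then so is `R → Γ(X, 𝒪_X)` — by flat base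
change `Γ(X ×_R R̂, 𝒪) = R̂ ⊗_R Γ(X, 𝒪_X)` the former is `R̂ ⊗_R` the latter, `Γ(X, 𝒪_X)` is a
finite `R`-module, and bijectivity of maps of finite modules descends along `R̂ ⊗_R −`.
[cite: StacksProject, Tag 02KH (degree 0) and Tag 02O5 (degree 0)] [cite: AtiyahMacdonald1969,
Prop. 10.13 and Thm. 10.17] -/
theorem bijective_algebraMapΓ_of_bijective_baseChange_adicCompletion
    (h' : Function.Bijective (algebraMapΓ (pullback.snd f (Spec.map (CommRingCat.ofHom
      (algebraMap R (AdicCompletion (maximalIdeal R) R))))))) :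
    Function.Bijective (algebraMapΓ f) := by
  haveI : CompactSpace X := QuasiCompact.compactSpace_of_compactSpace f
  haveI : QuasiSeparatedSpace X := quasiSeparatedSpace_of_quasiSeparated f
  haveI : Module.Finite R (Sections f ⊤) := moduleFinite_sections_top_of_isProper f
  rw [bijective_algebraMapΓ_iff_linearMap]
  exact bijective_of_lTensor_adicCompletion_bijective _
    ((bijective_algebraMapΓ_baseChange_iff_lTensor f).mp h')

/-- **Stein from the formal levels over a Noetherian local ring.** Let `(R, 𝔪)` be a Noetherian
local ring and `f : X → Spec R` proper such that `R/𝔪ⁿ⁺¹ → Γ(X ×_R R/𝔪ⁿ⁺¹, 𝒪)` is bijective for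
every `n`. Then `R → Γ(X, 𝒪_X)` is bijective: the base change `X_{R̂} → Spec R̂` to the completion
has the same levels (`R̂/𝔪̂ⁿ⁺¹ = R/𝔪ⁿ⁺¹`), hence is Stein by the complete case, and one descends.
[cite: GortzWedhorn2023, Thm. 24.37 and Cor. 24.63] [cite: AtiyahMacdonald1969, Prop. 10.13,
Prop. 10.15 and Thm. 10.17] [cite: StacksProject, Tag 02KH and Tag 0316] -/
theorem bijective_algebraMapΓ_of_isLocalRing
    (hlev : ∀ n, Function.Bijective (algebraMapΓ (toSpec (maximalIdeal R) f n))) :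
    Function.Bijective (algebraMapΓ f) := by
  set Rh := AdicCompletion (maximalIdeal R) R
  haveI : IsNoetherianRing Rh :=
    Literature.AlgebraicGeometry.Resolution.isNoetherianRing_adicCompletion_maximalIdeal R
  set bι : Spec (.of Rh) ⟶ Spec (.of R) := Spec.map (CommRingCat.ofHom (algebraMap R Rh))
  apply bijective_algebraMapΓ_of_bijective_baseChange_adicCompletion f
  apply bijective_algebraMapΓ_of_isAdicComplete (pullback.snd f bι)
  intro n
  -- the level `n` of `X_{R̂}` is the level `n` of `X`, up to `R̂/𝔪̂ⁿ⁺¹ ≃ R/𝔪ⁿ⁺¹`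
  obtain ⟨e, he⟩ := exists_ringEquiv_quotient_adicCompletion (R := R) (n + 1)
  have h1 := bijective_algebraMapΓ_snd_of_ringEquiv f (base (maximalIdeal R) n) e (hlev n)
  have hb : Spec.map (CommRingCat.ofHom e.toRingHom) ≫ base (maximalIdeal R) n =
      base (maximalIdeal Rh) n ≫ bι := by
    change Spec.map _ ≫ Spec.map _ = Spec.map _ ≫ Spec.map _
    rw [← Spec.map_comp, ← Spec.map_comp, ← CommRingCat.ofHom_comp, ← CommRingCat.ofHom_comp, he]
  rw [hb] at h1
  exact bijective_algebraMapΓ_snd_snd_of_comp f bι (base (maximalIdeal Rh) n) h1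

end Main

end Literature.AlgebraicGeometry.Morphisms
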